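/-
Copyright: statement-level skeleton of a published paper (lit-balaban cell, Phase-2 proof seat p39 gen 6). No proof claims
beyond what the kernel checks below.
-/
import Literature.MathematicalPhysics.QuantumFieldTheory.Balaban1983to89.B3KernelConvolutionTorus

/-!
# B3 — T. Bałaban, *(Higgs)₂,₃ quantum fields in a finite volume. III. Renormalization*, CMP **88** (1983) 411–445
[Balaban1983Higgs3], p. 439 [PDF 29] (and p. 437): the SECOND lattice convolution estimate behind *"using the same method as in
(3.16) we get some convergent expressions"* — two kernels with the `|y − y′|^{−1}e^{−δ|y−y′|}` singularity of an UNDIFFERENTIATED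
propagator in `d = 3` (possibly with a unit-block-local operator in between) convolve to a BOUNDED kernel with an exponential tail,
at ALL sites (diagonal included), uniformly in the lattice spacing `ξ ≤ 1` and in the volume

statement-level skeleton of published theorems with citation tags; proofs where landed; nothing here is a claim about
the Yang–Mills mass gap

PDF held: `paper:balaban1983-higgs-2-3-quantum-fields-finite-volume` (journal page = PDF page + 410); pp. 437/439 [PDF 27/29] read
in the OCR text (`p0027.txt`, `p0029.txt`).  Rows **B3.Eq3.21-3.24** / **B3.Eq3.11-3.17** of `HOME/lit-balaban-r15/ROWS-B3.md` (fold
owner r15): p. 439 *"Rescaling from the η-lattice to the L^{−j″}-lattice and using the same method as in (3.16) we get some convergent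
expressions plus q²g(x)g′(x)Σ_{x′}ξ^d(∂^ξ_μC^ξ)(x − x′)C^ξ(x − x′)"* — the "convergent expressions" are the cross terms of the first
(3.23) term under `G^ξ_{j″}(0) = C^ξ + M`, whose boundedness rests on the boundedness of the kernels `M = ξ^dG^ξ(0)·D·C^ξ` and
`C^ξ∘G^ξ(0)` — convolutions of two `|y−y′|^{−1}`-singular kernels.  Companion of this seat's `B3KernelConvolutionTorus` (the
`|y−y′|^{−2}`-singular case, by the half-distance split); here the mechanism is AM–GM: `(|y−z||z−y′|)^{−1} ≤ ½(|y−z|^{−2} + |z−y′|^{−2})`,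
each square being summable in `d = 3`.
* `sum_profile_one_le` — `Σ_z ξ³(ξ·max(1,|y−z|))^{−1}e^{−αξ|y−z|} ≤ 1 + radialConst 3 α ξ 1`; `sum_exp_le` — `Σ_z ξ³e^{−αξ|y−z|} ≤
  1 + radialConst 3 α ξ 2` (diagonal term + `B3TorusRadialSums.riemann_radial_sum_le`, κ = 1 resp. 0).
* **`conv11_le`** — if `|A(y,z)| ≤ a(ξ·max(1,|y−z|))^{−1}e^{−αξ|y−z|}` and `|B(z,y′)| ≤ b(ξ·max(1,|z−y′|))^{−1}e^{−βξ|z−y′|}` at all sites,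
  then for ALL `y, y′` and every `0 ≤ γ` with `2γ ≤ α, β`: `Σ_z ξ³|A(y,z)||B(z,y′)| ≤ (ab/2)(2 + R_{α/2} + R_{β/2})·e^{−γξ|y−y′|}`
  (`R_c = radialConst 3 c ξ 0`) — a BOUNDED kernel.
* **`conv11_block_le`** — the same through a block-local kernel `|E(z,z′)| ≤ e₁ξ³`, `E(z,z′) ≠ 0 ⇒ ξ|z−z′| ≤ 2`: for all `y, y′`,
  `Σ_{z,z′}ξ³|A(y,z)||E(z,z′)||B(z′,y′)| ≤ (e₁ab/2)e^{2γ}[(1 + R_{α/2})(1 + S_{β/2}) + (1 + S_{α/2})(1 + R_{β/2})]·e^{−γξ|y−y′|}`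
  (`S_c = radialConst 3 c ξ 2`).
Mathlib + `B3KernelConvolutionTorus` (hence `B3Bound316`, `B3TorusRadialSums`) only; theorems only, no definitions, no named facts;
standard axioms.  Unit `lit-balaban-p39-g6` (Phase-2 proof seat p39, gen 6), HOME `run/shared/lean/pub/lit-balaban/`, 2026-08-21.
-/

open scoped BigOperators

namespace Literature.MathematicalPhysics.QuantumFieldTheory.Balaban1983to89.B3KernelConvolutionTorusSup

open LatticeFieldCalculus B3Sect3ScalarSelfEnergy B3TorusRadialSums B3Bound316 B3KernelConvolutionTorus

noncomputable section

variable {P : Params} {j : ℕ}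

/-! ## 1. Two more profile sums -/

/-- **`Σ_z ξ³·(ξ·max(1,|y − z|))^{−1}e^{−αξ|y−z|} ≤ 1 + radialConst 3 α ξ 1`** (`d = 3`, `0 < ξ ≤ 1`): the lattice sum of the profile of an
UNDIFFERENTIATED propagator — diagonal term `ξ² ≤ 1` plus the Riemann radial sum with `κ = 1`. [cite: Balaban1983Higgs3, (3.16) p.437] -/
theorem sum_profile_one_le (hd : P.d = 3) {ξ : ℝ} (hξ : 0 < ξ) (hξ1 : ξ ≤ 1) {α : ℝ} (hα : 0 < α) (y : Site P j) :
    ∑ z : Site P j, ξ ^ P.d * ((ξ * max (1 : ℝ) (supDist y z : ℝ))⁻¹ * Real.exp (-(α * (ξ * (supDist y z : ℝ))))) ≤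
      1 + radialConst P.d α ξ 1 := by
  classical
  set F : Site P j → ℝ := fun z =>
    ξ ^ P.d * ((ξ * max (1 : ℝ) (supDist y z : ℝ))⁻¹ * Real.exp (-(α * (ξ * (supDist y z : ℝ))))) with hF
  have hsplit : ∑ z : Site P j, F z = F y + ∑ z ∈ Finset.univ.filter (fun z : Site P j => z ≠ y), F z := by
    rw [← Finset.add_sum_erase Finset.univ F (Finset.mem_univ y)]
    congr 1
    refine Finset.sum_congr ?_ fun _ _ => rfl
    ext z; simp [Finset.mem_erase]
  have hdiag : F y ≤ 1 := by
    simp only [hF, (supDist_eq_zero_iff y y).mpr rfl, Nat.cast_zero, mul_zero, neg_zero, Real.exp_zero, mul_one,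
      max_eq_left (zero_le_one : (0 : ℝ) ≤ 1)]
    rw [hd]
    have : ξ ^ 3 * ξ⁻¹ = ξ ^ 2 := by field_simp
    rw [this]
    exact pow_le_one₀ hξ.le hξ1
  have hoff : ∑ z ∈ Finset.univ.filter (fun z : Site P j => z ≠ y), F z ≤ radialConst P.d α ξ 1 := by
    have h := riemann_radial_sum_le y hα hξ (κ := 1) (p := 1) (by omega)
    have heq : ∀ z ∈ Finset.univ.filter (fun z : Site P j => z ≠ y),
        F z = ξ ^ P.d * (((ξ * supDist y z) ^ 1)⁻¹ * Real.exp (-(α * (ξ * supDist y z)))) := by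
      intro z hz
      rw [hF, pow_one]
      simp only [max_one_supDist_of_ne (Finset.mem_filter.mp hz).2]
    rw [Finset.sum_congr rfl heq]
    simpa [radialConst] using h
  rw [hsplit]
  exact add_le_add hdiag hoff

/-- **`Σ_z ξ³·e^{−αξ|y−z|} ≤ 1 + radialConst 3 α ξ 2`** (`d = 3`, `0 < ξ ≤ 1`): the plain exponential lattice sum (κ = 0).
[cite: Balaban1983Higgs3, (3.16) p.437] -/
theorem sum_exp_le (hd : P.d = 3) {ξ : ℝ} (hξ : 0 < ξ) (hξ1 : ξ ≤ 1) {α : ℝ} (hα : 0 < α) (y : Site P j) :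
    ∑ z : Site P j, ξ ^ P.d * Real.exp (-(α * (ξ * (supDist y z : ℝ)))) ≤ 1 + radialConst P.d α ξ 2 := by
  classical
  set F : Site P j → ℝ := fun z => ξ ^ P.d * Real.exp (-(α * (ξ * (supDist y z : ℝ)))) with hF
  have hsplit : ∑ z : Site P j, F z = F y + ∑ z ∈ Finset.univ.filter (fun z : Site P j => z ≠ y), F z := by
    rw [← Finset.add_sum_erase Finset.univ F (Finset.mem_univ y)]
    congr 1
    refine Finset.sum_congr ?_ fun _ _ => rfl
    ext z; simp [Finset.mem_erase]
  have hdiag : F y ≤ 1 := by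
    simp only [hF, (supDist_eq_zero_iff y y).mpr rfl, Nat.cast_zero, mul_zero, neg_zero, Real.exp_zero, mul_one]
    exact pow_le_one₀ hξ.le hξ1
  have hoff : ∑ z ∈ Finset.univ.filter (fun z : Site P j => z ≠ y), F z ≤ radialConst P.d α ξ 2 := by
    have h := riemann_radial_sum_le y hα hξ (κ := 0) (p := 2) (by omega)
    have heq : ∀ z ∈ Finset.univ.filter (fun z : Site P j => z ≠ y),
        F z = ξ ^ P.d * (((ξ * supDist y z) ^ 0)⁻¹ * Real.exp (-(α * (ξ * supDist y z)))) := by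
      intro z _
      rw [hF, pow_zero, inv_one, one_mul]
    rw [Finset.sum_congr rfl heq]
    simpa [radialConst] using h
  rw [hsplit]
  exact add_le_add hdiag hoff

/-! ## 2. Two `|y − z|^{−1}`-singular kernels convolved: a bounded kernel (AM–GM) -/

/-- kernel: the AM–GM step on the regularised singularities, `q_A·q_B ≤ ½(q_A² + q_B²)`. [folklore] -/
private theorem mul_le_half_sq_add_sq (u v : ℝ) : u * v ≤ (u ^ 2 + v ^ 2) / 2 := by
  nlinarith [sq_nonneg (u - v)]

/-- **CONVOLUTION OF TWO `|y − z|^{−1}`-SINGULAR KERNELS IS BOUNDED** (`d = 3`, volume element `ξ³`, `0 < ξ ≤ 1`): if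
`|A(y,z)| ≤ a(ξ·max(1,|y−z|))^{−1}e^{−αξ|y−z|}` and `|B(z,y′)| ≤ b(ξ·max(1,|z−y′|))^{−1}e^{−βξ|z−y′|}` at all sites, then for ALL `y, y′` and
every `0 ≤ γ` with `2γ ≤ α`, `2γ ≤ β`: `Σ_z ξ³|A(y,z)||B(z,y′)| ≤ (ab/2)(2 + radialConst 3 (α/2) ξ 0 + radialConst 3 (β/2) ξ 0)·e^{−γξ|y−y′|}`.
Mechanism: AM–GM `(|y−z||z−y′|)^{−1} ≤ ½(|y−z|^{−2} + |z−y′|^{−2})`, each square summable (`B3KernelConvolutionTorus.sum_profile_le`),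
half of each exponential kept for the decay (`ξ|y−z| + ξ|z−y′| ≥ ξ|y−y′|`). [cite: Balaban1983Higgs3, (3.23) p.439] -/
theorem conv11_le (hd : P.d = 3) {ξ : ℝ} (hξ : 0 < ξ) (hξ1 : ξ ≤ 1) {α β γ a b : ℝ} (hα : 0 < α) (hβ : 0 < β)
    (hγ : 0 ≤ γ) (hγα : 2 * γ ≤ α) (hγβ : 2 * γ ≤ β) (ha : 0 ≤ a) (hb : 0 ≤ b) (A B : Kernel P j)
    (hA : ∀ y z : Site P j, |A y z| ≤
      a * ((ξ * max (1 : ℝ) (supDist y z : ℝ))⁻¹ * Real.exp (-(α * (ξ * (supDist y z : ℝ))))))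
    (hB : ∀ z y' : Site P j, |B z y'| ≤
      b * ((ξ * max (1 : ℝ) (supDist z y' : ℝ))⁻¹ * Real.exp (-(β * (ξ * (supDist z y' : ℝ))))))
    (y y' : Site P j) :
    ∑ z : Site P j, ξ ^ P.d * (|A y z| * |B z y'|) ≤
      a * b / 2 * (2 + radialConst P.d (α / 2) ξ 0 + radialConst P.d (β / 2) ξ 0) *
        Real.exp (-(γ * (ξ * (supDist y y' : ℝ)))) := by
  classical
  set t : ℝ := ξ * (supDist y y' : ℝ) with ht
  have hξd : 0 ≤ ξ ^ P.d := by positivity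
  -- the two square profiles with half rates
  set u : Site P j → ℝ := fun z => ξ ^ P.d * (((ξ * max (1 : ℝ) (supDist y z : ℝ)) ^ 2)⁻¹ *
    Real.exp (-(α / 2 * (ξ * (supDist y z : ℝ))))) with hu
  set v : Site P j → ℝ := fun z => ξ ^ P.d * (((ξ * max (1 : ℝ) (supDist z y' : ℝ)) ^ 2)⁻¹ *
    Real.exp (-(β / 2 * (ξ * (supDist z y' : ℝ))))) with hv
  have hu0 : ∀ z, 0 ≤ u z := fun z => by positivity
  have hv0 : ∀ z, 0 ≤ v z := fun z => by positivity
  -- pointwise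
  have hpt : ∀ z : Site P j, ξ ^ P.d * (|A y z| * |B z y'|) ≤
      a * b / 2 * Real.exp (-(γ * t)) * (u z + v z) := by
    intro z
    set p : ℝ := ξ * (supDist y z : ℝ) with hp
    set q : ℝ := ξ * (supDist z y' : ℝ) with hq
    set qa : ℝ := (ξ * max (1 : ℝ) (supDist y z : ℝ))⁻¹ with hqa
    set qb : ℝ := (ξ * max (1 : ℝ) (supDist z y' : ℝ))⁻¹ with hqb
    have hqa0 : 0 ≤ qa := by positivity
    have hqb0 : 0 ≤ qb := by positivity
    have htri : t ≤ p + q := by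
      have h1 := supDist_triangle_real y z y'
      rw [ht, hp, hq, ← mul_add]; exact mul_le_mul_of_nonneg_left h1 hξ.le
    have hp0 : 0 ≤ p := by positivity
    have hq0 : 0 ≤ q := by positivity
    -- exponentials: `e^{−αp}e^{−βq} ≤ e^{−(α/2)p}e^{−(β/2)q}e^{−γt}`
    have hexp : Real.exp (-(α * p)) * Real.exp (-(β * q)) ≤
        Real.exp (-(α / 2 * p)) * Real.exp (-(β / 2 * q)) * Real.exp (-(γ * t)) := by
      rw [← Real.exp_add, ← Real.exp_add, ← Real.exp_add]
      apply Real.exp_le_exp.mpr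
      nlinarith
    have hea : Real.exp (-(α / 2 * p)) ≤ 1 := Real.exp_le_one_iff.mpr (by nlinarith)
    have heb : Real.exp (-(β / 2 * q)) ≤ 1 := Real.exp_le_one_iff.mpr (by nlinarith)
    -- AM–GM on the singularities, each square keeping its own half exponential
    have hsq : qa * qb * (Real.exp (-(α / 2 * p)) * Real.exp (-(β / 2 * q))) ≤
        (qa ^ 2 * Real.exp (-(α / 2 * p)) + qb ^ 2 * Real.exp (-(β / 2 * q))) / 2 := by
      have h1 : qa * qb * (Real.exp (-(α / 2 * p)) * Real.exp (-(β / 2 * q))) ≤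
          (qa ^ 2 + qb ^ 2) / 2 * (Real.exp (-(α / 2 * p)) * Real.exp (-(β / 2 * q))) :=
        mul_le_mul_of_nonneg_right (mul_le_half_sq_add_sq qa qb) (by positivity)
      have h2 : qa ^ 2 * (Real.exp (-(α / 2 * p)) * Real.exp (-(β / 2 * q))) ≤ qa ^ 2 * Real.exp (-(α / 2 * p)) := by
        have := mul_le_mul_of_nonneg_left heb (Real.exp_pos (-(α / 2 * p))).le
        rw [mul_one] at this
        exact mul_le_mul_of_nonneg_left this (sq_nonneg _)
      have h3 : qb ^ 2 * (Real.exp (-(α / 2 * p)) * Real.exp (-(β / 2 * q))) ≤ qb ^ 2 * Real.exp (-(β / 2 * q)) := by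
        have := mul_le_mul_of_nonneg_right hea (Real.exp_pos (-(β / 2 * q))).le
        rw [one_mul] at this
        exact mul_le_mul_of_nonneg_left this (sq_nonneg _)
      nlinarith
    calc ξ ^ P.d * (|A y z| * |B z y'|)
        ≤ ξ ^ P.d * ((a * (qa * Real.exp (-(α * p)))) * (b * (qb * Real.exp (-(β * q))))) := by
          refine mul_le_mul_of_nonneg_left ?_ hξd
          exact mul_le_mul (by rw [hqa, hp]; exact hA y z) (by rw [hqb, hq]; exact hB z y') (abs_nonneg _) (by positivity)
      _ = a * b * ξ ^ P.d * (qa * qb * (Real.exp (-(α * p)) * Real.exp (-(β * q)))) := by ring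
      _ ≤ a * b * ξ ^ P.d * (qa * qb * (Real.exp (-(α / 2 * p)) * Real.exp (-(β / 2 * q)) * Real.exp (-(γ * t)))) := by
          refine mul_le_mul_of_nonneg_left (mul_le_mul_of_nonneg_left hexp (by positivity)) (by positivity)
      _ = a * b * Real.exp (-(γ * t)) * (ξ ^ P.d * (qa * qb * (Real.exp (-(α / 2 * p)) * Real.exp (-(β / 2 * q))))) := by
          ring
      _ ≤ a * b * Real.exp (-(γ * t)) *
            (ξ ^ P.d * ((qa ^ 2 * Real.exp (-(α / 2 * p)) + qb ^ 2 * Real.exp (-(β / 2 * q))) / 2)) := by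
          refine mul_le_mul_of_nonneg_left (mul_le_mul_of_nonneg_left hsq hξd) (by positivity)
      _ = a * b / 2 * Real.exp (-(γ * t)) * (u z + v z) := by
          simp only [hu, hv, hqa, hqb, hp, hq, inv_pow]; ring
  have hsu : ∑ z, u z ≤ 1 + radialConst P.d (α / 2) ξ 0 := sum_profile_le hd hξ hξ1 (half_pos hα) y
  have hsv : ∑ z, v z ≤ 1 + radialConst P.d (β / 2) ξ 0 := by
    have h := sum_profile_le hd hξ hξ1 (half_pos hβ) y'
    simp only [supDist_comm y'] at h
    exact h
  calc ∑ z : Site P j, ξ ^ P.d * (|A y z| * |B z y'|)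
      ≤ ∑ z : Site P j, a * b / 2 * Real.exp (-(γ * t)) * (u z + v z) := Finset.sum_le_sum fun z _ => hpt z
    _ = a * b / 2 * Real.exp (-(γ * t)) * (∑ z, u z + ∑ z, v z) := by
        rw [← Finset.mul_sum, Finset.sum_add_distrib]
    _ ≤ a * b / 2 * Real.exp (-(γ * t)) * ((1 + radialConst P.d (α / 2) ξ 0) + (1 + radialConst P.d (β / 2) ξ 0)) :=
        mul_le_mul_of_nonneg_left (add_le_add hsu hsv) (by positivity)
    _ = _ := by rw [ht]; ring

/-! ## 3. The same through a unit-block-local kernel -/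

/-- **THE BOUNDED CONVOLUTION THROUGH A BLOCK-LOCAL KERNEL** (`d = 3`, `0 < ξ ≤ 1`): if in addition `|E(z,z′)| ≤ e₁ξ³` everywhere and
`E(z,z′) ≠ 0` only when `ξ|z − z′|_∞ ≤ 2`, then for ALL `y, y′` and every `0 ≤ γ` with `2γ ≤ α`, `2γ ≤ β`:
`Σ_{z,z′}ξ³|A(y,z)||E(z,z′)||B(z′,y′)| ≤ (e₁ab/2)e^{2γ}[(1 + R_{α/2})(1 + S_{β/2}) + (1 + S_{α/2})(1 + R_{β/2})]e^{−γξ|y−y′|}`,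
`R_c = radialConst 3 c ξ 0` (square profile sums), `S_c = radialConst 3 c ξ 2` (plain exponential sums).
[cite: Balaban1983Higgs3, (3.23) p.439] -/
theorem conv11_block_le (hd : P.d = 3) {ξ : ℝ} (hξ : 0 < ξ) (hξ1 : ξ ≤ 1) {α β γ a b e₁ : ℝ} (hα : 0 < α) (hβ : 0 < β)
    (hγ : 0 ≤ γ) (hγα : 2 * γ ≤ α) (hγβ : 2 * γ ≤ β) (ha : 0 ≤ a) (hb : 0 ≤ b) (he : 0 ≤ e₁) (A E B : Kernel P j)
    (hA : ∀ y z : Site P j, |A y z| ≤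
      a * ((ξ * max (1 : ℝ) (supDist y z : ℝ))⁻¹ * Real.exp (-(α * (ξ * (supDist y z : ℝ))))))
    (hB : ∀ z y' : Site P j, |B z y'| ≤
      b * ((ξ * max (1 : ℝ) (supDist z y' : ℝ))⁻¹ * Real.exp (-(β * (ξ * (supDist z y' : ℝ))))))
    (hE : ∀ z z' : Site P j, |E z z'| ≤ e₁ * ξ ^ P.d)
    (hEs : ∀ z z' : Site P j, E z z' ≠ 0 → ξ * (supDist z z' : ℝ) ≤ 2)
    (y y' : Site P j) :
    ∑ z : Site P j, ∑ z' : Site P j, ξ ^ P.d * (|A y z| * |E z z'| * |B z' y'|) ≤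
      e₁ * a * b / 2 * Real.exp (2 * γ) *
        ((1 + radialConst P.d (α / 2) ξ 0) * (1 + radialConst P.d (β / 2) ξ 2) +
          (1 + radialConst P.d (α / 2) ξ 2) * (1 + radialConst P.d (β / 2) ξ 0)) *
        Real.exp (-(γ * (ξ * (supDist y y' : ℝ)))) := by
  classical
  set t : ℝ := ξ * (supDist y y' : ℝ) with ht
  have hξd : 0 ≤ ξ ^ P.d := by positivity
  -- the four one-variable sums: squares `u`, `v` and plain exponentials `eu`, `ev`
  set u : Site P j → ℝ := fun z => ξ ^ P.d * (((ξ * max (1 : ℝ) (supDist y z : ℝ)) ^ 2)⁻¹ *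
    Real.exp (-(α / 2 * (ξ * (supDist y z : ℝ))))) with hu
  set v : Site P j → ℝ := fun z' => ξ ^ P.d * (((ξ * max (1 : ℝ) (supDist z' y' : ℝ)) ^ 2)⁻¹ *
    Real.exp (-(β / 2 * (ξ * (supDist z' y' : ℝ))))) with hv
  set eu : Site P j → ℝ := fun z => ξ ^ P.d * Real.exp (-(α / 2 * (ξ * (supDist y z : ℝ)))) with heu
  set ev : Site P j → ℝ := fun z' => ξ ^ P.d * Real.exp (-(β / 2 * (ξ * (supDist z' y' : ℝ)))) with hev
  have hu0 : ∀ z, 0 ≤ u z := fun z => by positivity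
  have hv0 : ∀ z, 0 ≤ v z := fun z => by positivity
  have heu0 : ∀ z, 0 ≤ eu z := fun z => by positivity
  have hev0 : ∀ z, 0 ≤ ev z := fun z => by positivity
  set K : ℝ := e₁ * a * b / 2 * Real.exp (2 * γ) * Real.exp (-(γ * t)) with hK
  have hK0 : 0 ≤ K := by positivity
  -- pointwise bound for every pair
  have hpt : ∀ z z' : Site P j, ξ ^ P.d * (|A y z| * |E z z'| * |B z' y'|) ≤ K * (u z * ev z' + eu z * v z') := by
    intro z z'
    by_cases hE0 : E z z' = 0
    · rw [hE0, abs_zero, mul_zero, zero_mul, mul_zero]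
      exact mul_nonneg hK0 (add_nonneg (mul_nonneg (hu0 z) (hev0 z')) (mul_nonneg (heu0 z) (hv0 z')))
    · have hblk := hEs z z' hE0
      set p : ℝ := ξ * (supDist y z : ℝ) with hp
      set q : ℝ := ξ * (supDist z' y' : ℝ) with hq
      set qa : ℝ := (ξ * max (1 : ℝ) (supDist y z : ℝ))⁻¹ with hqa
      set qb : ℝ := (ξ * max (1 : ℝ) (supDist z' y' : ℝ))⁻¹ with hqb
      have hqa0 : 0 ≤ qa := by positivity
      have hqb0 : 0 ≤ qb := by positivity
      have hp0 : 0 ≤ p := by positivity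
      have hq0 : 0 ≤ q := by positivity
      have htri : t ≤ p + 2 + q := by
        have h1 := supDist_triangle_real y z y'
        have h2 := supDist_triangle_real z z' y'
        have h3 : (supDist y y' : ℝ) ≤ (supDist y z : ℝ) + (supDist z z' : ℝ) + (supDist z' y' : ℝ) := by linarith
        have h4 := mul_le_mul_of_nonneg_left h3 hξ.le
        rw [ht, hp, hq]; nlinarith
      have hexp : Real.exp (-(α * p)) * Real.exp (-(β * q)) ≤
          Real.exp (-(α / 2 * p)) * Real.exp (-(β / 2 * q)) * (Real.exp (2 * γ) * Real.exp (-(γ * t))) := by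
        rw [← Real.exp_add, ← Real.exp_add, ← Real.exp_add, ← Real.exp_add]
        apply Real.exp_le_exp.mpr
        nlinarith
      have hsq : qa * qb ≤ (qa ^ 2 + qb ^ 2) / 2 := mul_le_half_sq_add_sq qa qb
      calc ξ ^ P.d * (|A y z| * |E z z'| * |B z' y'|)
          ≤ ξ ^ P.d * ((a * (qa * Real.exp (-(α * p)))) * (e₁ * ξ ^ P.d) * (b * (qb * Real.exp (-(β * q))))) := by
            refine mul_le_mul_of_nonneg_left ?_ hξd
            refine mul_le_mul (mul_le_mul (by rw [hqa, hp]; exact hA y z) (hE z z') (abs_nonneg _) (by positivity))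
              (by rw [hqb, hq]; exact hB z' y') (abs_nonneg _) (by positivity)
        _ = e₁ * a * b * (ξ ^ P.d * ξ ^ P.d) * (qa * qb) * (Real.exp (-(α * p)) * Real.exp (-(β * q))) := by ring
        _ ≤ e₁ * a * b * (ξ ^ P.d * ξ ^ P.d) * ((qa ^ 2 + qb ^ 2) / 2) *
              (Real.exp (-(α / 2 * p)) * Real.exp (-(β / 2 * q)) * (Real.exp (2 * γ) * Real.exp (-(γ * t)))) := by
            refine mul_le_mul (mul_le_mul_of_nonneg_left hsq (by positivity)) hexp (by positivity) (by positivity)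
        _ = K * (u z * ev z' + eu z * v z') := by
            simp only [hK, hu, hv, heu, hev, hqa, hqb, hp, hq, inv_pow]; ring
  -- the sums
  have hsu : ∑ z, u z ≤ 1 + radialConst P.d (α / 2) ξ 0 := sum_profile_le hd hξ hξ1 (half_pos hα) y
  have hsv : ∑ z', v z' ≤ 1 + radialConst P.d (β / 2) ξ 0 := by
    have h := sum_profile_le hd hξ hξ1 (half_pos hβ) y'
    simp only [supDist_comm y'] at h
    exact h
  have hseu : ∑ z, eu z ≤ 1 + radialConst P.d (α / 2) ξ 2 := sum_exp_le hd hξ hξ1 (half_pos hα) y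
  have hsev : ∑ z', ev z' ≤ 1 + radialConst P.d (β / 2) ξ 2 := by
    have h := sum_exp_le hd hξ hξ1 (half_pos hβ) y'
    simp only [supDist_comm y'] at h
    exact h
  have hS0 : 0 ≤ ∑ z', ev z' := Finset.sum_nonneg fun z _ => hev0 z
  have hV0 : 0 ≤ ∑ z', v z' := Finset.sum_nonneg fun z _ => hv0 z
  have hRa : 0 ≤ 1 + radialConst P.d (α / 2) ξ 0 := by
    have := radialConst_nonneg P.d (half_pos hα) hξ.le 0; linarith
  have hSa : 0 ≤ 1 + radialConst P.d (α / 2) ξ 2 := by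
    have := radialConst_nonneg P.d (half_pos hα) hξ.le 2; linarith
  calc ∑ z : Site P j, ∑ z' : Site P j, ξ ^ P.d * (|A y z| * |E z z'| * |B z' y'|)
      ≤ ∑ z : Site P j, ∑ z' : Site P j, K * (u z * ev z' + eu z * v z') :=
        Finset.sum_le_sum fun z _ => Finset.sum_le_sum fun z' _ => hpt z z'
    _ = K * ((∑ z, u z) * (∑ z', ev z') + (∑ z, eu z) * (∑ z', v z')) := by
        rw [Finset.sum_mul_sum, Finset.sum_mul_sum, ← Finset.sum_add_distrib, Finset.mul_sum]
        refine Finset.sum_congr rfl fun z _ => ?_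
        rw [← Finset.sum_add_distrib, Finset.mul_sum]
    _ ≤ K * ((1 + radialConst P.d (α / 2) ξ 0) * (1 + radialConst P.d (β / 2) ξ 2) +
          (1 + radialConst P.d (α / 2) ξ 2) * (1 + radialConst P.d (β / 2) ξ 0)) := by
        refine mul_le_mul_of_nonneg_left (add_le_add ?_ ?_) hK0
        · exact mul_le_mul hsu hsev hS0 hRa
        · exact mul_le_mul hseu hsv hV0 hSa
    _ = _ := by rw [hK, ht]; ring

end

end Literature.MathematicalPhysics.QuantumFieldTheory.Balaban1983to89.B3KernelConvolutionTorusSup
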